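import Summits.QuantumFields.YangMills.Theses.ConvexGribovBody
import Literature.MathematicalPhysics.QuantumFieldTheory.LatticeGaugeProofs

/-!
# Transport of a layer observable through the axis swap `0 ↔ 1`
(crux `ConvexGribovBody.PoincareToGap`, line `Sketch`, stub F3)

On the symmetric torus `(ℤ/(2S+1))⁴` let `Φ U (x, k) := U (x ∘ swap₀₁, swap₀₁ k)` be the exchange
of the coordinate axes `0` (time) and `1` on gauge configurations, and let `A` be a bounded
measurable gauge-invariant link-Lipschitz observable reading only the links of the layer
`Λ₀ = {e | e.1 0 = 0 ∧ e.1 1 = 0 ∧ e.2 ∉ {0, 1}}`.  Assuming that the measure `μ` is `Φ`-invariant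
(`μ.map Φ = μ`; for Wilson's measure this is the hypercubic symmetry, a neighbouring stub), we
prove the pure bookkeeping statement `stub_axisSwap_transport`:

* (i) `A ∘ Φ` is again measurable, bounded, gauge invariant
  (`Φ (gaugeTransform g U) = gaugeTransform (g ∘ swap) (Φ U)`), reads only
  `{e | e.1 0 = 0 ∧ e.1 1 = 0 ∧ e.2 ≠ 0}`, and is link-Lipschitz with the same constant (re-index
  the edge sum by the edge involution `ε e = (e.1 ∘ swap, swap e.2)`);
* (ii) `Φ ∘ T¹_y = T⁰_y ∘ Φ` (`(y e₀) ∘ swap = y e₁`), so the direction-`1` autocovariances of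
  `A ∘ Φ`, summed over `y ∈ ℤ/(2S+1)`, are the temporal autocovariances of `A` (change of
  variables under `Φ`);
* (iii) the time-zero Dirichlet form of `A ∘ Φ` equals that of `A`:
  `(A ∘ Φ) (update U e g) = A (update (Φ U) (ε e) g)` and `(Φ U) (ε e) = U e`, so the metric
  slope of `A ∘ Φ` at `(U, e)` is the metric slope of `A` at `(Φ U, ε e)`; integrate with
  `μ.map Φ = μ`, re-index by `ε`, and observe that both Dirichlet sums only see the links of `Λ₀`
  (off `Λ₀` the difference quotient of `A` vanishes identically and `limsup 0 = 0`), on which both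
  indicator conditions hold.

The proof is organised through a general statement `transport_of_involutive` for an arbitrary
edge involution `ε` (with the handful of geometric identities it needs as hypotheses), specialised
at the end to the axis swap.  Everything is elementary (folklore; E. Seiler, LNP 159 (1982), Ch. 1:
Wilson's theory is invariant under the hypercubic group).
-/

noncomputable section

open scoped BigOperators Topology
open MeasureTheory Filter
open Literature.MathematicalPhysics.QuantumFieldTheory

namespace Summit.QuantumFields.YangMills.Theorems.PoincareToGap

variable {d L : ℕ} {G : Type*}

/-! ### Generalities on re-indexing a configuration along an edge involution -/

/-- `limsup` of the zero function is `0` along EVERY filter (also along `⊥`). [folklore] -/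
private theorem limsup_const_zero {α : Type*} (F : Filter α) :
    Filter.limsup (fun _ : α => (0 : ℝ)) F = 0 := by
  by_cases h : F.NeBot
  · exact Filter.limsup_const 0
  · rw [Filter.not_neBot] at h
    simp [h, Filter.limsup, Filter.limsSup]

/-- Re-indexing a sum of indicator-weighted terms along an involution `ε`: if `X' i = X (ε i)`,
`X` vanishes off `Λ₀`, and both `P i` and `P (ε i)` hold on `Λ₀`, then `∑ [P] X' = ∑ [P] X`.
[folklore] -/
private theorem sum_ite_eq_of_involutive {ι : Type*} [Fintype ι] (ε : ι → ι)
    (hε : Function.Involutive ε) (P : ι → Prop) [DecidablePred P] (Λ₀ : Set ι)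
    (hP1 : ∀ i ∈ Λ₀, P i) (hP2 : ∀ i ∈ Λ₀, P (ε i)) (X X' : ι → ℝ)
    (hX' : ∀ i, X' i = X (ε i)) (hX0 : ∀ i ∉ Λ₀, X i = 0) :
    ∑ i, (if P i then X' i else 0) = ∑ i, (if P i then X i else 0) := by
  have h1 : ∀ i, (if P i then X' i else 0) = (fun j => if P (ε j) then X j else 0) (ε i) :=
    fun i => by simp only [hε i, hX' i]
  rw [Finset.sum_congr rfl fun i _ => h1 i,
    hε.bijective.sum_comp (fun j => if P (ε j) then X j else 0)]
  refine Finset.sum_congr rfl fun i _ => ?_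
  by_cases hi : i ∈ Λ₀
  · rw [if_pos (hP2 i hi), if_pos (hP1 i hi)]
  · rw [hX0 i hi, ite_self, ite_self]

/-- Updating a link commutes with the re-indexing along an involution `ε`:
`(U[e ↦ g]) ∘ ε = (U ∘ ε)[ε e ↦ g]`. [folklore] -/
private theorem update_comp_invol [DecidableEq (Edge d L)] (ε : Edge d L → Edge d L)
    (hε : Function.Involutive ε) (U : GaugeConfig d L G) (e : Edge d L) (g : G) :
    Function.update (fun e' => U (ε e')) (ε e) g = fun e' => Function.update U e g (ε e') := by
  funext e'
  by_cases h : e' = ε e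
  · subst h
    simp only [Function.update_self, hε e]
  · have h' : ε e' ≠ e := fun h'' => h (by rw [← h'', hε e'])
    simp only [Function.update_of_ne h, Function.update_of_ne h']

section Involution

variable [MeasurableSpace G]

/-- Change of variables under the re-indexing `U ↦ U ∘ ε` along an edge involution `ε`, a measurable
involution of the configuration space, for a `(U ↦ U ∘ ε)`-invariant measure. [folklore] -/
private theorem integral_comp_invol (ε : Edge d L → Edge d L) (hε : Function.Involutive ε)
    (μ : Measure (GaugeConfig d L G))
    (hΦ : μ.map (fun (U : GaugeConfig d L G) e => U (ε e)) = μ) (f : GaugeConfig d L G → ℝ) :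
    ∫ U, f (fun e => U (ε e)) ∂μ = ∫ U, f U ∂μ := by
  have h := integral_map_equiv (μ := μ)
    (MeasurableEquiv.arrowCongr' (Function.Involutive.toPerm ε hε) (MeasurableEquiv.refl G)) f
  have hc : ⇑(MeasurableEquiv.arrowCongr' (Function.Involutive.toPerm ε hε)
      (MeasurableEquiv.refl G)) = fun (U : GaugeConfig d L G) e => U (ε e) := rfl
  rw [hc, hΦ] at h
  exact h.symm

/-- Re-indexing commutes with torus translations, given the compatibility
`ε (x - w, k) = ((ε e).1 - v, (ε e).2)` of `ε` with the two translation vectors. [folklore] -/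
private theorem comp_torusConfigShift (ε : Edge d L → Edge d L) (v w : Site d L)
    (hvw : ∀ e : Edge d L, ε (e.1 - w, e.2) = ((ε e).1 - v, (ε e).2)) (U : GaugeConfig d L G) :
    (fun e => (torusConfigShift v U) (ε e)) = torusConfigShift w (fun e => U (ε e)) := by
  funext e
  simp only [torusConfigShift_apply]
  rw [hvw]

variable [TopologicalSpace G]

/-- The metric-slope Dirichlet term of `A ∘ Φ` at the link `e` is the Dirichlet term of `A` at the
link `ε e` (`Φ U = U ∘ ε`, `μ` `Φ`-invariant). [folklore] -/
private theorem dirichletTerm_comp_invol [DecidableEq (Edge d L)] (ε : Edge d L → Edge d L)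
    (hε : Function.Involutive ε) (δ : G → G → ℝ) (μ : Measure (GaugeConfig d L G))
    (hΦ : μ.map (fun (U : GaugeConfig d L G) e => U (ε e)) = μ) (A : GaugeConfig d L G → ℝ)
    (e : Edge d L) :
    ∫ U, (Filter.limsup (fun g : G =>
        |A (fun e' => (Function.update U e g) (ε e')) - A (fun e' => U (ε e'))| / δ g (U e))
        (𝓝[≠] (U e))) ^ 2 ∂μ =
    ∫ U, (Filter.limsup (fun g : G => |A (Function.update U (ε e) g) - A U| / δ g (U (ε e)))
        (𝓝[≠] (U (ε e)))) ^ 2 ∂μ := by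
  refine Eq.trans ?_ (integral_comp_invol ε hε μ hΦ (fun V => (Filter.limsup
    (fun g : G => |A (Function.update V (ε e) g) - A V| / δ g (V (ε e))) (𝓝[≠] (V (ε e)))) ^ 2))
  refine integral_congr_ae (Filter.Eventually.of_forall fun U => ?_)
  simp only [update_comp_invol ε hε, hε e]

/-- Off the set of links read by `A`, the Dirichlet term of `A` vanishes. [folklore] -/
private theorem dirichletTerm_eq_zero [DecidableEq (Edge d L)] (δ : G → G → ℝ)
    (μ : Measure (GaugeConfig d L G)) (A : GaugeConfig d L G → ℝ) (Λ₀ : Set (Edge d L))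
    (hAd : DependsOn A Λ₀) (e : Edge d L) (he : e ∉ Λ₀) :
    ∫ U, (Filter.limsup (fun g : G => |A (Function.update U e g) - A U| / δ g (U e))
        (𝓝[≠] (U e))) ^ 2 ∂μ = 0 := by
  have h : ∀ (U : GaugeConfig d L G) (g : G), A (Function.update U e g) = A U := fun U g =>
    hAd fun i hi => Function.update_of_ne (ne_of_mem_of_not_mem hi he) _ _
  simp [h, limsup_const_zero]

variable [Group G] [NeZero L]

/-- **Transport through an edge involution** (general form of `stub_axisSwap_transport`): for an
involution `ε` of the edges, compatible with the gauge action (`σ`), with the layer sets (`Λ₀ → D`),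
with the indicator `P` of the Dirichlet sum and with two families of translations (`v`, `w`), and a
`(U ↦ U ∘ ε)`-invariant measure `μ`, the observable `A ∘ (· ∘ ε)` inherits admissibility, its
`v`-autocovariance sum is the `w`-autocovariance sum of `A`, and its Dirichlet form is that of `A`.
[folklore] -/
private theorem transport_of_involutive [DecidableEq (Edge d L)]
    (ε : Edge d L → Edge d L) (hε : Function.Involutive ε)
    (σ : Site d L → Site d L) (hσ1 : ∀ e, (ε e).1 = σ e.1)
    (hσ2 : ∀ e, Site.shift (σ e.1) (ε e).2 = σ (e.1.shift e.2))
    (Λ₀ D : Set (Edge d L)) (hΛD : ∀ e ∈ Λ₀, ε e ∈ D)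
    (P : Edge d L → Prop) [DecidablePred P] (hP1 : ∀ e ∈ Λ₀, P e) (hP2 : ∀ e ∈ Λ₀, P (ε e))
    (v w : ZMod L → Site d L)
    (hvw : ∀ y (e : Edge d L), ε (e.1 - w y, e.2) = ((ε e).1 - v y, (ε e).2))
    (δ : G → G → ℝ) (μ : Measure (GaugeConfig d L G))
    (hΦ : μ.map (fun (U : GaugeConfig d L G) e => U (ε e)) = μ)
    (A : GaugeConfig d L G → ℝ) (hAm : Measurable A) (hM : ∃ M : ℝ, ∀ U, |A U| ≤ M)
    (hAg : IsGaugeInvariant A) (hAd : DependsOn A Λ₀)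
    (hK : ∃ K : ℝ, ∀ U V : GaugeConfig d L G, |A U - A V| ≤ K * ∑ e, δ (U e) (V e)) :
    (Measurable (fun U : GaugeConfig d L G => A (fun e => U (ε e))) ∧
      (∃ M : ℝ, ∀ U : GaugeConfig d L G, |A (fun e => U (ε e))| ≤ M) ∧
      IsGaugeInvariant (fun U : GaugeConfig d L G => A (fun e => U (ε e))) ∧
      DependsOn (fun U : GaugeConfig d L G => A (fun e => U (ε e))) D ∧
      (∃ K : ℝ, ∀ U V : GaugeConfig d L G,
        |A (fun e => U (ε e)) - A (fun e => V (ε e))| ≤ K * ∑ e, δ (U e) (V e))) ∧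
    (∑ y : ZMod L,
        (∫ U, A (fun e => U (ε e)) * A (fun e => (torusConfigShift (v y) U) (ε e)) ∂μ -
          (∫ U, A (fun e => U (ε e)) ∂μ) * ∫ U, A (fun e => U (ε e)) ∂μ) =
      ∑ n : ZMod L,
        (∫ U, A U * A (torusConfigShift (w n) U) ∂μ - (∫ U, A U ∂μ) * ∫ U, A U ∂μ)) ∧
    (∑ e : Edge d L, (if P e then
        ∫ U, (Filter.limsup (fun g : G =>
            |A (fun e' => (Function.update U e g) (ε e')) - A (fun e' => U (ε e'))| / δ g (U e))
            (𝓝[≠] (U e))) ^ 2 ∂μ else 0) =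
      ∑ e : Edge d L, (if P e then
        ∫ U, (Filter.limsup (fun g : G => |A (Function.update U e g) - A U| / δ g (U e))
            (𝓝[≠] (U e))) ^ 2 ∂μ else 0)) := by
  refine ⟨⟨?_, ?_, ?_, ?_, ?_⟩, ?_, ?_⟩
  · -- measurability
    exact hAm.comp (measurable_pi_lambda _ fun e => measurable_pi_apply (ε e))
  · -- boundedness
    obtain ⟨M, hM⟩ := hM
    exact ⟨M, fun U => hM _⟩
  · -- gauge invariance
    intro g U
    have hgt : (fun e => gaugeTransform g U (ε e)) =
        gaugeTransform (fun x => g (σ x)) (fun e => U (ε e)) := by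
      funext e
      simp only [gaugeTransform, hσ1 e, hσ2 e]
    show A (fun e => gaugeTransform g U (ε e)) = A (fun e => U (ε e))
    rw [hgt]
    exact hAg _ _
  · -- dependence on `D` only
    intro U V hUV
    exact hAd fun i hi => hUV (ε i) (hΛD i hi)
  · -- link-Lipschitz with the same constant
    obtain ⟨K, hK⟩ := hK
    refine ⟨K, fun U V => (hK _ _).trans (le_of_eq ?_)⟩
    congr 1
    exact hε.bijective.sum_comp (fun e => δ (U e) (V e))
  · -- autocovariance sums
    have h0 : ∫ U, A (fun e => U (ε e)) ∂μ = ∫ U, A U ∂μ := integral_comp_invol ε hε μ hΦ A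
    refine Finset.sum_congr rfl fun y _ => ?_
    rw [h0]
    congr 1
    refine Eq.trans ?_
      (integral_comp_invol ε hε μ hΦ (fun V => A V * A (torusConfigShift (w y) V)))
    refine integral_congr_ae (Filter.Eventually.of_forall fun U => ?_)
    show _ = A (fun e => U (ε e)) * A (torusConfigShift (w y) (fun e => U (ε e)))
    rw [← comp_torusConfigShift ε (v y) (w y) (hvw y) U]
  · -- Dirichlet forms
    exact sum_ite_eq_of_involutive ε hε P Λ₀ hP1 hP2
      (fun e => ∫ U, (Filter.limsup (fun g : G => |A (Function.update U e g) - A U| / δ g (U e))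
        (𝓝[≠] (U e))) ^ 2 ∂μ)
      (fun e => ∫ U, (Filter.limsup (fun g : G =>
        |A (fun e' => (Function.update U e g) (ε e')) - A (fun e' => U (ε e'))| / δ g (U e))
        (𝓝[≠] (U e))) ^ 2 ∂μ)
      (fun e => dirichletTerm_comp_invol ε hε δ μ hΦ A e)
      (fun e he => dirichletTerm_eq_zero δ μ A Λ₀ hAd e he)

end Involution

/-! ### The axis swap -/

/-- The edge map `(x, k) ↦ (x ∘ swap i j, swap i j k)` is an involution. [folklore] -/
private theorem swapEdge_involutive (i j : Fin d) :
    Function.Involutive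
      (fun e : Edge d L => ((fun k => e.1 (Equiv.swap i j k)), Equiv.swap i j e.2)) := by
  intro e
  simp only [Equiv.swap_apply_self, Prod.mk.eta]

/-- `Site.shift` commutes with the coordinate swap: `(x + e_m) ∘ swap = x ∘ swap + e_{swap m}`.
[folklore] -/
private theorem swap_shift (i j : Fin d) (e : Edge d L) :
    Site.shift (fun k => e.1 (Equiv.swap i j k)) (Equiv.swap i j e.2) =
      fun k => (e.1.shift e.2) (Equiv.swap i j k) := by
  funext k
  simp only [Site.shift, Pi.add_apply, Pi.single_apply, Equiv.swap_apply_eq_iff]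

/-- Translations and the coordinate swap: `(x - y eᵢ) ∘ swap = x ∘ swap - y eⱼ`. [folklore] -/
private theorem swap_sub_single (i j : Fin d) (y : ZMod L) (e : Edge d L) :
    ((fun k => (e.1 - (Pi.single i y : Site d L)) (Equiv.swap i j k)), Equiv.swap i j e.2) =
      ((fun k => e.1 (Equiv.swap i j k)) - (Pi.single j y : Site d L), Equiv.swap i j e.2) := by
  refine Prod.ext (funext fun k => ?_) rfl
  simp only [Pi.sub_apply, Pi.single_apply, Equiv.swap_apply_eq_iff, Equiv.swap_apply_left]

/-- F3 `stub_axisSwap_transport` — **transport of a `(2,3)`-layer observable through the axis swap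
`0 ↔ 1`** (pure bookkeeping; the swap invariance of `μ` is a hypothesis).  Let
`Φ U (x, k) := U (x ∘ swap₀₁, swap₀₁ k)` and let `A` be bounded measurable gauge-invariant
link-Lipschitz reading only the layer `Λ₀ = {e | e.1 0 = 0 ∧ e.1 1 = 0 ∧ e.2 ∉ {0, 1}}`.  Then
(i) `A ∘ Φ` is again bounded measurable gauge-invariant link-Lipschitz and reads only
`{e | e.1 0 = 0 ∧ e.1 1 = 0 ∧ e.2 ≠ 0}`; (ii) with `μ.map Φ = μ` the direction-`1` autocovariances
of `A ∘ Φ`, summed over `ℤ/(2S+1)`, are the temporal autocovariances of `A`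
(`Φ ∘ T¹_y = T⁰_y ∘ Φ`); (iii) the time-zero Dirichlet form of `A ∘ Φ` equals that of `A`.
[folklore] -/
theorem stub_axisSwap_transport :
    ∀ (G : Type) [Group G] [TopologicalSpace G] [IsTopologicalGroup G] [CompactSpace G]
      [MeasurableSpace G] [BorelSpace G] (r : LatticeRep G) (β : ℝ) (S : ℕ)
      (μ : Measure (GaugeConfig 4 (2 * S + 1) G)),
      μ = (wilsonMeasure r.ρ β : Measure (GaugeConfig 4 (2 * S + 1) G)) →
      μ.map (fun (U : GaugeConfig 4 (2 * S + 1) G) (e : Edge 4 (2 * S + 1)) =>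
          U (fun k => e.1 (Equiv.swap 0 1 k), Equiv.swap 0 1 e.2)) = μ →
    ∀ A : GaugeConfig 4 (2 * S + 1) G → ℝ, Measurable A → (∃ M : ℝ, ∀ U, |A U| ≤ M) →
      IsGaugeInvariant A →
      DependsOn A {e : Edge 4 (2 * S + 1) | e.1 0 = 0 ∧ e.1 1 = 0 ∧ e.2 ≠ 0 ∧ e.2 ≠ 1} →
      (∃ K : ℝ, ∀ U V : GaugeConfig 4 (2 * S + 1) G,
        |A U - A V| ≤ K * ∑ e, Real.sqrt (∑ a, ∑ b, ‖(r.ρ (U e) - r.ρ (V e)) a b‖ ^ 2)) →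
    (Measurable (fun U : GaugeConfig 4 (2 * S + 1) G =>
        A (fun e => U (fun k => e.1 (Equiv.swap 0 1 k), Equiv.swap 0 1 e.2))) ∧
      (∃ M : ℝ, ∀ U : GaugeConfig 4 (2 * S + 1) G,
        |A (fun e => U (fun k => e.1 (Equiv.swap 0 1 k), Equiv.swap 0 1 e.2))| ≤ M) ∧
      IsGaugeInvariant (fun U : GaugeConfig 4 (2 * S + 1) G =>
        A (fun e => U (fun k => e.1 (Equiv.swap 0 1 k), Equiv.swap 0 1 e.2))) ∧
      DependsOn (fun U : GaugeConfig 4 (2 * S + 1) G =>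
        A (fun e => U (fun k => e.1 (Equiv.swap 0 1 k), Equiv.swap 0 1 e.2)))
        {e : Edge 4 (2 * S + 1) | e.1 0 = 0 ∧ e.1 1 = 0 ∧ e.2 ≠ 0} ∧
      (∃ K : ℝ, ∀ U V : GaugeConfig 4 (2 * S + 1) G,
        |A (fun e => U (fun k => e.1 (Equiv.swap 0 1 k), Equiv.swap 0 1 e.2)) -
            A (fun e => V (fun k => e.1 (Equiv.swap 0 1 k), Equiv.swap 0 1 e.2))| ≤
          K * ∑ e, Real.sqrt (∑ a, ∑ b, ‖(r.ρ (U e) - r.ρ (V e)) a b‖ ^ 2))) ∧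
    (∑ y : ZMod (2 * S + 1),
        (∫ U, A (fun e => U (fun k => e.1 (Equiv.swap 0 1 k), Equiv.swap 0 1 e.2)) *
            A (fun e => (torusConfigShift (Pi.single (1 : Fin 4) y : Site 4 (2 * S + 1)) U)
              (fun k => e.1 (Equiv.swap 0 1 k), Equiv.swap 0 1 e.2)) ∂μ -
          (∫ U, A (fun e => U (fun k => e.1 (Equiv.swap 0 1 k), Equiv.swap 0 1 e.2)) ∂μ) *
            ∫ U, A (fun e => U (fun k => e.1 (Equiv.swap 0 1 k), Equiv.swap 0 1 e.2)) ∂μ) =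
      ∑ n : ZMod (2 * S + 1),
        (∫ U, A U * A (torusConfigShift (Pi.single (0 : Fin 4) n : Site 4 (2 * S + 1)) U) ∂μ -
          (∫ U, A U ∂μ) * ∫ U, A U ∂μ)) ∧
    (∑ e : Edge 4 (2 * S + 1), (if e.1 0 = 0 ∧ e.2 ≠ 0 then
        ∫ U, (Filter.limsup (fun g : G =>
            |A (fun e' => (Function.update U e g) (fun k => e'.1 (Equiv.swap 0 1 k), Equiv.swap 0 1 e'.2)) -
              A (fun e' => U (fun k => e'.1 (Equiv.swap 0 1 k), Equiv.swap 0 1 e'.2))| /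
            Real.sqrt (∑ a, ∑ b, ‖(r.ρ g - r.ρ (U e)) a b‖ ^ 2)) (𝓝[≠] (U e))) ^ 2 ∂μ else 0) =
      ∑ e : Edge 4 (2 * S + 1), (if e.1 0 = 0 ∧ e.2 ≠ 0 then
        ∫ U, (Filter.limsup (fun g : G => |A (Function.update U e g) - A U| /
            Real.sqrt (∑ a, ∑ b, ‖(r.ρ g - r.ρ (U e)) a b‖ ^ 2)) (𝓝[≠] (U e))) ^ 2 ∂μ else 0)) := by
  intro G _ _ _ _ _ _ r β S μ _ hΦ A hAm hM hAg hAd hK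
  have hΛD : ∀ e ∈ {e : Edge 4 (2 * S + 1) | e.1 0 = 0 ∧ e.1 1 = 0 ∧ e.2 ≠ 0 ∧ e.2 ≠ 1},
      ((fun k => e.1 (Equiv.swap 0 1 k), Equiv.swap 0 1 e.2) : Edge 4 (2 * S + 1)) ∈
        {e : Edge 4 (2 * S + 1) | e.1 0 = 0 ∧ e.1 1 = 0 ∧ e.2 ≠ 0} := by
    intro e he
    simp only [Set.mem_setOf_eq, Equiv.swap_apply_left, Equiv.swap_apply_right] at he ⊢
    exact ⟨he.2.1, he.1, by rw [Equiv.swap_apply_of_ne_of_ne he.2.2.1 he.2.2.2]; exact he.2.2.1⟩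
  have hP1 : ∀ e ∈ {e : Edge 4 (2 * S + 1) | e.1 0 = 0 ∧ e.1 1 = 0 ∧ e.2 ≠ 0 ∧ e.2 ≠ 1},
      e.1 0 = 0 ∧ e.2 ≠ 0 := fun e he => ⟨he.1, he.2.2.1⟩
  have hP2 : ∀ e ∈ {e : Edge 4 (2 * S + 1) | e.1 0 = 0 ∧ e.1 1 = 0 ∧ e.2 ≠ 0 ∧ e.2 ≠ 1},
      ((fun k => e.1 (Equiv.swap 0 1 k), Equiv.swap 0 1 e.2) : Edge 4 (2 * S + 1)).1 0 = 0 ∧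
        ((fun k => e.1 (Equiv.swap 0 1 k), Equiv.swap 0 1 e.2) : Edge 4 (2 * S + 1)).2 ≠ 0 := by
    intro e he
    simp only [Set.mem_setOf_eq, Equiv.swap_apply_left] at he ⊢
    exact ⟨he.2.1, by rw [Equiv.swap_apply_of_ne_of_ne he.2.2.1 he.2.2.2]; exact he.2.2.1⟩
  exact transport_of_involutive
    (fun e : Edge 4 (2 * S + 1) => ((fun k => e.1 (Equiv.swap 0 1 k)), Equiv.swap 0 1 e.2))
    (swapEdge_involutive 0 1)
    (fun (x : Site 4 (2 * S + 1)) k => x (Equiv.swap 0 1 k)) (fun _ => rfl)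
    (fun e => swap_shift 0 1 e)
    {e : Edge 4 (2 * S + 1) | e.1 0 = 0 ∧ e.1 1 = 0 ∧ e.2 ≠ 0 ∧ e.2 ≠ 1}
    {e : Edge 4 (2 * S + 1) | e.1 0 = 0 ∧ e.1 1 = 0 ∧ e.2 ≠ 0} hΛD
    (fun e : Edge 4 (2 * S + 1) => e.1 0 = 0 ∧ e.2 ≠ 0) hP1 hP2
    (fun y => (Pi.single (1 : Fin 4) y : Site 4 (2 * S + 1)))
    (fun n => (Pi.single (0 : Fin 4) n : Site 4 (2 * S + 1)))
    (fun y e => swap_sub_single 0 1 y e)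
    (fun g h => Real.sqrt (∑ a, ∑ b, ‖(r.ρ g - r.ρ h) a b‖ ^ 2)) μ hΦ A hAm hM hAg hAd hK

end Summit.QuantumFields.YangMills.Theorems.PoincareToGap

end
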